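import Mathlib.Analysis.SpecialFunctions.Pow.Complex
import Mathlib.Analysis.SpecialFunctions.Complex.Arg
import Mathlib.Analysis.SpecialFunctions.Exp
import HarnessLib

/-!
# Escape to infinity: elementary lemmas

Helpers for `ZilberEacComplexQuadricEscape.lean` (Exponential-Algebraic Closedness by diagonal
escape over quadric graph bases; first open rung, Mantova–Masser, PLMS 129 (2024), §1 p. 5):
the principal square root (`w² = E`, `Re w ≥ 0`, `(Re w)² = (‖E‖ + Re E)/2`), a sign choice
making `Re(-iσ/α) ≥ 0`, and the limit `(1+u)^N e^{-u} → 0`.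

HONEST FRAMING: infrastructure for a modest new sub-rung of EAC; nothing here bears on Schanuel's
conjecture.
-/

noncomputable section

open Complex Metric Set Filter Topology

set_option linter.dupNamespace false

namespace Summit.Schanuel.Schanuel.Theorems

/-! ### The principal square root: a lower bound for the real part -/

/-- **Real part of the principal square root.** For every `E ∈ ℂ`, `w = E^{1/2}` satisfies
`w² = E`, `0 ≤ Re w` and `(Re w)² = (‖E‖ + Re E)/2`; in particular `E ∈ slitPlane` as soon as
`‖E‖ + Re E > 0`. [folklore] -/
theorem principalSqrt_facts (E : ℂ) :
    (E ^ ((2 : ℂ)⁻¹)) ^ 2 = E ∧ 0 ≤ (E ^ ((2 : ℂ)⁻¹)).re ∧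
      (E ^ ((2 : ℂ)⁻¹)).re ^ 2 = (‖E‖ + E.re) / 2 := by
  set w : ℂ := E ^ ((2 : ℂ)⁻¹) with hw
  have hsq : w ^ 2 = E := by
    have h := Complex.cpow_nat_inv_pow E (n := 2) two_ne_zero
    simp only [Nat.cast_ofNat] at h
    exact h
  have hwre : 0 ≤ w.re := by
    by_cases hE : E = 0
    · simp [hw, hE]
    rw [hw, Complex.cpow_def_of_ne_zero hE, Complex.exp_re]
    refine mul_nonneg (Real.exp_pos _).le (Real.cos_nonneg_of_mem_Icc ?_)
    have harg1 : Complex.arg E ≤ Real.pi := Complex.arg_le_pi E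
    have harg2 : -Real.pi < Complex.arg E := Complex.neg_pi_lt_arg E
    have h2 : (2 : ℂ)⁻¹ = ((2⁻¹ : ℝ) : ℂ) := by push_cast; rfl
    have him : (Complex.log E * (2 : ℂ)⁻¹).im = Complex.arg E / 2 := by
      rw [h2, Complex.mul_im, Complex.ofReal_re, Complex.ofReal_im, mul_zero, zero_add,
        Complex.log_im]
      ring
    rw [him, Set.mem_Icc]
    constructor <;> linarith
  have hnormE : ‖E‖ = w.re ^ 2 + w.im ^ 2 := by
    rw [← hsq, norm_pow, Complex.sq_norm, Complex.normSq_apply]; ring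
  have hreE : E.re = w.re ^ 2 - w.im ^ 2 := by
    rw [← hsq]; simp [sq, Complex.mul_re]
  exact ⟨hsq, hwre, by rw [hnormE, hreE]; ring⟩

/-- For `α ≠ 0` one of `∓ i/α` has non-negative real part: a sign `σ ∈ {1, -1}` with
`0 ≤ Re(-iσ/α)`. [folklore] -/
theorem exists_sign_re_nonneg (α : ℂ) :
    ∃ σ : ℝ, (σ = 1 ∨ σ = -1) ∧ 0 ≤ (-(I * σ) / α).re := by
  by_cases h : 0 ≤ (-(I * (1 : ℝ)) / α).re
  · exact ⟨1, Or.inl rfl, h⟩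
  · refine ⟨-1, Or.inr rfl, ?_⟩
    have : (-(I * ((-1 : ℝ) : ℂ)) / α) = -(-(I * ((1 : ℝ) : ℂ)) / α) := by push_cast; ring
    rw [this, Complex.neg_re]
    linarith [not_le.mp h]

/-- `(1 + u)^N e^{-u} → 0` as `u → ∞`. [folklore] -/
theorem tendsto_one_add_pow_mul_exp_neg (N : ℕ) :
    Tendsto (fun u : ℝ => (1 + u) ^ N * Real.exp (-u)) atTop (𝓝 0) := by
  have h1 := Real.tendsto_pow_mul_exp_neg_atTop_nhds_zero N
  have h2 : Tendsto (fun u : ℝ => (1 + u) ^ N * Real.exp (-(1 + u))) atTop (𝓝 0) :=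
    h1.comp (tendsto_atTop_add_const_left _ 1 tendsto_id)
  have h3 : Tendsto (fun u : ℝ => Real.exp 1 * ((1 + u) ^ N * Real.exp (-(1 + u)))) atTop
      (𝓝 0) := by
    have := h2.const_mul (Real.exp 1); rwa [mul_zero] at this
  refine h3.congr fun u => ?_
  rw [show -(1 + u) = -u + (-1) by ring, Real.exp_add, Real.exp_neg (1 : ℝ)]
  field_simp

end Summit.Schanuel.Schanuel.Theorems
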